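import Mathlib
import Literature.Probability.Process.BackwardMartingaleConvergence
import HarnessLib

/-!
# Durrett §§4.6–4.7, Exercises: `E(Y_n | 𝓕_n) → E(Y | 𝓕_∞)` in `L¹` along `Y_n → Y` in `L¹`
# (4.6.7), dominated convergence for conditional expectations along decreasing σ-fields (4.7.2),
# and exchangeable square integrable sequences are nonnegatively correlated (4.7.4)

[topic Probability/Process]

| Durrett 2019, §4.6 Exercise 4.6.7 (p. 224), §4.7 Exercises 4.7.2, 4.7.4 (p. 228) | declaration | status |
|---|---|---|
| 4.6.7: `𝓕_n ↑ 𝓕_∞`, `Y_n → Y` in `L¹` ⟹ `E(Y_n | 𝓕_n) → E(Y | 𝓕_∞)` in `L¹` | `Durrett2019_exercise_4_6_7` | proved |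
| 4.7.2: `Y_n → Y_{−∞}` a.s., `|Y_n| ≤ Z ∈ L¹`, `𝓕_n ↓ 𝓕_{−∞}` ⟹ `E(Y_n | 𝓕_n) → E(Y_{−∞} | 𝓕_{−∞})` a.s. | `Durrett2019_exercise_4_7_2` | proved |
| 4.7.4: `X_1, X_2, …` exchangeable, `EX_i² < ∞` ⟹ `E(X_1X_2) ≥ 0` | `Durrett2019_exercise_4_7_4` | proved |

Theorem 4.6.8 (Lévy's upward theorem `E(Y | 𝓕_n) → E(Y | 𝓕_∞)` a.s. and in `L¹`) is Mathlib's
`MeasureTheory.tendsto_ae_condExp` / `MeasureTheory.tendsto_eLpNorm_condExp` and is not restated.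

Proofs.  4.6.7: `‖E(Y_n|𝓕_n) − E(Y|𝓕_∞)‖₁ ≤ ‖E(Y_n − Y | 𝓕_n)‖₁ + ‖E(Y|𝓕_n) − E(Y|𝓕_∞)‖₁
≤ ‖Y_n − Y‖₁ + ‖E(Y|𝓕_n) − E(Y|𝓕_∞)‖₁` (contraction in `L¹`, Theorem 4.1.11, and Theorem 4.6.8).
4.7.2: the proof of Theorem 4.6.10 (the tree's `Durrett2019_thm_4_6_10`) verbatim, with Lévy's
downward theorem (Theorem 4.7.3, the tree's `Durrett2019_thm_4_7_3`) replacing the upward one: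
with `V_N = sup_{n ≥ N} |Y_n − Y|` (`≤ 2Z`, `↓ 0`),
`limsup_n |E(Y_n|𝓕_n) − E(Y|𝓕_n)| ≤ lim_n E(V_N|𝓕_n) = E(V_N|𝓕_{−∞}) ↓ 0` a.s.
4.7.4 (an elementary road, shorter in the tree than de Finetti's theorem): by exchangeability
`E X_i² = E X_1² =: a` and `E X_i X_j = E X_1 X_2 =: b` for `i ≠ j` — only the laws of the PAIRS
`(X_i, X_j)` enter, so this is all we assume — hence
`0 ≤ E(X_1 + ⋯ + X_n)² = n a + n(n − 1) b` for every `n`, forcing `b ≥ 0`.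

## References
* [Durrett2019] R. Durrett, *Probability: Theory and Examples*, 5th ed., Cambridge Series in
  Statistical and Probabilistic Mathematics 49, Cambridge University Press (2019): §4.6
  (Uniform integrability, convergence in `L¹`), Theorems 4.6.8, 4.6.10 and Exercise 4.6.7,
  pp. 222–224; §4.7 (Backwards martingales), Theorem 4.7.3 and Exercises 4.7.2, 4.7.4, pp. 225–228.
-/

namespace Literature.Probability.Process

open _root_.MeasureTheory _root_.ProbabilityTheory Filter
open scoped ENNReal NNReal Topology

variable {Ω : Type*} {m₀ : MeasurableSpace Ω} {μ : Measure Ω}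

/-! ## Exercise 4.6.7 -/

/-- **Durrett, Exercise 4.6.7.** If `𝓕_n ↑ 𝓕_∞` and `Y_n → Y` in `L¹`, then
`E(Y_n | 𝓕_n) → E(Y | 𝓕_∞)` in `L¹` (`𝓕_∞ = ⋁_n 𝓕_n`).
[cite: Durrett2019, §4.6 Exercise 4.6.7, p. 224] -/
theorem Durrett2019_exercise_4_6_7 [IsFiniteMeasure μ] (ℱ : Filtration ℕ m₀) {Y : ℕ → Ω → ℝ}
    {Ylim : Ω → ℝ} (hY : ∀ n, Integrable (Y n) μ) (hYlim : Integrable Ylim μ)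
    (hL1 : Tendsto (fun n => eLpNorm (Y n - Ylim) 1 μ) atTop (𝓝 0)) :
    Tendsto (fun n => eLpNorm (μ[Y n | ℱ n] - μ[Ylim | ⨆ n, ℱ n]) 1 μ) atTop (𝓝 0) := by
  have hbound : ∀ n, eLpNorm (μ[Y n | ℱ n] - μ[Ylim | ⨆ n, ℱ n]) 1 μ ≤
      eLpNorm (Y n - Ylim) 1 μ + eLpNorm (μ[Ylim | ℱ n] - μ[Ylim | ⨆ n, ℱ n]) 1 μ := by
    intro n
    have h1 : eLpNorm (μ[Y n | ℱ n] - μ[Ylim | ℱ n]) 1 μ ≤ eLpNorm (Y n - Ylim) 1 μ := by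
      rw [eLpNorm_congr_ae (condExp_sub (hY n) hYlim (ℱ n)).symm]
      exact eLpNorm_condExp_le_eLpNorm _ le_rfl
    calc eLpNorm (μ[Y n | ℱ n] - μ[Ylim | ⨆ n, ℱ n]) 1 μ
        = eLpNorm ((μ[Y n | ℱ n] - μ[Ylim | ℱ n]) + (μ[Ylim | ℱ n] - μ[Ylim | ⨆ n, ℱ n])) 1 μ := by
          rw [sub_add_sub_cancel]
      _ ≤ eLpNorm (μ[Y n | ℱ n] - μ[Ylim | ℱ n]) 1 μ +
            eLpNorm (μ[Ylim | ℱ n] - μ[Ylim | ⨆ n, ℱ n]) 1 μ :=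
          eLpNorm_add_le (integrable_condExp.sub integrable_condExp).aestronglyMeasurable
            (integrable_condExp.sub integrable_condExp).aestronglyMeasurable le_rfl
      _ ≤ _ := add_le_add h1 le_rfl
  have hlim : Tendsto (fun n => eLpNorm (Y n - Ylim) 1 μ +
      eLpNorm (μ[Ylim | ℱ n] - μ[Ylim | ⨆ n, ℱ n]) 1 μ) atTop (𝓝 0) := by
    simpa using hL1.add (tendsto_eLpNorm_condExp (μ := μ) (ℱ := ℱ) Ylim)
  exact tendsto_of_tendsto_of_tendsto_of_le_of_le tendsto_const_nhds hlim (fun n => zero_le) hbound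

/-! ## Exercise 4.7.4 -/

/-- `E(X_1 + ⋯ + X_n)² = n a + n(n−1) b` when `E X_i² = a` and `E X_i X_j = b` for `i ≠ j`.
[cite: Durrett2019, §4.7 Exercise 4.7.4, p. 228 (proof step)] -/
theorem integral_sq_sum_of_pair_moments {X : ℕ → Ω → ℝ} (hL2 : ∀ i, MemLp (X i) 2 μ) {a b : ℝ}
    (ha : ∀ i, ∫ ω, X i ω * X i ω ∂μ = a) (hb : ∀ i j, i ≠ j → ∫ ω, X i ω * X j ω ∂μ = b)
    (n : ℕ) :
    ∫ ω, (∑ i ∈ Finset.range n, X i ω) ^ 2 ∂μ = n * a + n * (n - 1) * b := by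
  have hint : ∀ i j, Integrable (fun ω => X i ω * X j ω) μ := fun i j =>
    (hL2 i).integrable_mul (hL2 j)
  have hrow : ∀ i, Integrable (fun ω => ∑ j ∈ Finset.range n, X i ω * X j ω) μ := fun i =>
    integrable_finsetSum _ fun j _ => hint i j
  have e : ∀ ω, (∑ i ∈ Finset.range n, X i ω) ^ 2 =
      ∑ i ∈ Finset.range n, ∑ j ∈ Finset.range n, X i ω * X j ω := fun ω => by
    rw [sq, Finset.sum_mul_sum]
  simp_rw [e]
  rw [integral_finsetSum _ fun i _ => hrow i]
  have hi : ∀ i ∈ Finset.range n,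
      ∫ ω, ∑ j ∈ Finset.range n, X i ω * X j ω ∂μ = a + ((n : ℝ) - 1) * b := by
    intro i hi
    rw [integral_finsetSum _ fun j _ => hint i j]
    have hij : ∀ j ∈ Finset.range n,
        ∫ ω, X i ω * X j ω ∂μ = b + (if i = j then a - b else 0) := by
      intro j _
      by_cases hij : i = j
      · subst hij
        rw [if_pos rfl, ha]
        ring
      · rw [if_neg hij, hb i j hij]
        ring
    rw [Finset.sum_congr rfl hij, Finset.sum_add_distrib, Finset.sum_const, Finset.card_range,
      Finset.sum_ite_eq, if_pos hi, nsmul_eq_mul]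
    ring
  rw [Finset.sum_congr rfl hi, Finset.sum_const, Finset.card_range, nsmul_eq_mul]
  ring

/-- **Durrett, Exercise 4.7.4.** If `X_1, X_2, … ∈ ℝ` are exchangeable with `EX_i² < ∞`, then
`E(X_1 X_2) ≥ 0`.  Of exchangeability only the consequence actually used is assumed: every pair
`(X_i, X_j)`, `i ≠ j`, has the law of `(X_1, X_2)` (here, `0`-indexed, of `(X_0, X_1)`).
Proof: `0 ≤ E(X_1 + ⋯ + X_n)² = n EX_1² + n(n−1) E(X_1X_2)` for all `n`.
[cite: Durrett2019, §4.7 Exercise 4.7.4, p. 228] -/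
theorem Durrett2019_exercise_4_7_4 [IsFiniteMeasure μ] {X : ℕ → Ω → ℝ}
    (hpair : ∀ i j, i ≠ j →
      IdentDistrib (fun ω => (X i ω, X j ω)) (fun ω => (X 0 ω, X 1 ω)) μ μ)
    (h2 : MemLp (X 0) 2 μ) :
    0 ≤ ∫ ω, X 0 ω * X 1 ω ∂μ := by
  have hXi : ∀ i, IdentDistrib (X i) (X 0) μ μ := fun i =>
    (hpair i (i + 1) (by omega)).comp measurable_fst
  have hL2 : ∀ i, MemLp (X i) 2 μ := fun i => (hXi i).symm.memLp_snd h2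
  have ha : ∀ i, ∫ ω, X i ω * X i ω ∂μ = ∫ ω, X 0 ω * X 0 ω ∂μ := fun i =>
    ((hXi i).comp (measurable_id.mul measurable_id : Measurable fun x : ℝ => x * x)).integral_eq
  have hb : ∀ i j, i ≠ j → ∫ ω, X i ω * X j ω ∂μ = ∫ ω, X 0 ω * X 1 ω ∂μ := fun i j hij =>
    ((hpair i j hij).comp
      (measurable_fst.mul measurable_snd : Measurable fun p : ℝ × ℝ => p.1 * p.2)).integral_eq
  have hsq := integral_sq_sum_of_pair_moments hL2 ha hb
  have ha0 : 0 ≤ ∫ ω, X 0 ω * X 0 ω ∂μ := integral_nonneg fun ω => mul_self_nonneg _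
  by_contra hneg
  have hb0 : ∫ ω, X 0 ω * X 1 ω ∂μ < 0 := not_le.1 hneg
  obtain ⟨n, hn⟩ := exists_nat_gt ((∫ ω, X 0 ω * X 0 ω ∂μ) / (-∫ ω, X 0 ω * X 1 ω ∂μ) + 1)
  have hpos : 0 ≤ (n : ℝ) * (∫ ω, X 0 ω * X 0 ω ∂μ) +
      n * (n - 1) * (∫ ω, X 0 ω * X 1 ω ∂μ) := by
    rw [← hsq n]
    exact integral_nonneg fun ω => sq_nonneg _
  have hdiv : 0 ≤ (∫ ω, X 0 ω * X 0 ω ∂μ) / (-∫ ω, X 0 ω * X 1 ω ∂μ) := div_nonneg ha0 (by linarith)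
  have hn1 : (1 : ℝ) < n := by linarith
  have hkey : (∫ ω, X 0 ω * X 0 ω ∂μ) + ((n : ℝ) - 1) * (∫ ω, X 0 ω * X 1 ω ∂μ) < 0 := by
    have h1 : (∫ ω, X 0 ω * X 0 ω ∂μ) / (-∫ ω, X 0 ω * X 1 ω ∂μ) < n - 1 := by linarith
    have h2 := (div_lt_iff₀ (by linarith : (0 : ℝ) < -∫ ω, X 0 ω * X 1 ω ∂μ)).1 h1
    linarith
  have hfac : (n : ℝ) * (∫ ω, X 0 ω * X 0 ω ∂μ) + n * (n - 1) * (∫ ω, X 0 ω * X 1 ω ∂μ) =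
      n * ((∫ ω, X 0 ω * X 0 ω ∂μ) + (n - 1) * (∫ ω, X 0 ω * X 1 ω ∂μ)) := by ring
  rw [hfac] at hpos
  have hnpos : (0 : ℝ) < n := by linarith
  exact absurd hpos (not_le.2 (mul_neg_of_pos_of_neg hnpos hkey))

/-! ## Exercise 4.7.2: dominated convergence for conditional expectations, decreasing σ-fields -/

/-- `|E(g | m)| ≤ E(|g| | m)` a.s. [cite: Durrett2019, §4.1 Theorem 4.1.9 (4.1.2), p. 193 (proof step for Exercise 4.7.2)] -/
theorem abs_condExp_ae_le_condExp_abs {m : MeasurableSpace Ω} {g : Ω → ℝ} (hg : Integrable g μ) :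
    ∀ᵐ ω ∂μ, |(μ[g | m]) ω| ≤ (μ[fun ω => |g ω| | m]) ω := by
  have h1 : μ[g | m] ≤ᵐ[μ] μ[fun ω => |g ω| | m] :=
    condExp_mono hg hg.abs (ae_of_all _ fun ω => le_abs_self _)
  have h2 : μ[-g | m] ≤ᵐ[μ] μ[fun ω => |g ω| | m] :=
    condExp_mono hg.neg hg.abs (ae_of_all _ fun ω => neg_le_abs _)
  filter_upwards [h1, h2, condExp_neg (μ := μ) (m := m) g] with ω h1 h2 h3
  rw [h3, Pi.neg_apply] at h2
  exact abs_le.2 ⟨by linarith, h1⟩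

/-- **Durrett, Exercise 4.7.2 (the backwards analogue of Theorem 4.6.10).** Suppose
`Y_n → Y_{−∞}` a.s. as `n → −∞` and `|Y_n| ≤ Z` a.s., where `EZ < ∞`.  If `𝓕_n ↓ 𝓕_{−∞}`, then
`E(Y_n | 𝓕_n) → E(Y_{−∞} | 𝓕_{−∞})` a.s.  (Here the index `n : ℕ` increases, `𝓕` is antitone and
`𝓕_{−∞} = ⨅_n 𝓕_n`; proof as for Theorem 4.6.10 with Lévy's downward theorem — the tree's
`Durrett2019_thm_4_7_3` — in place of the upward one: with `V_N = sup_{n ≥ N} |Y_n − Y|`,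
`limsup_n |E(Y_n − Y | 𝓕_n)| ≤ lim_n E(V_N | 𝓕_n) = E(V_N | 𝓕_{−∞}) ↓ 0`.)
[cite: Durrett2019, §4.7 Exercise 4.7.2, p. 228] -/
theorem Durrett2019_exercise_4_7_2 [IsFiniteMeasure μ] {ℱ : ℕ → MeasurableSpace Ω}
    (hanti : Antitone ℱ) (hle : ∀ n, ℱ n ≤ m₀) {Y : ℕ → Ω → ℝ} {Yl Z : Ω → ℝ}
    (hY : ∀ n, Measurable (Y n)) (hYl : Measurable Yl) (hZ : Integrable Z μ)
    (hdom : ∀ n, ∀ᵐ ω ∂μ, |Y n ω| ≤ Z ω)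
    (hlim : ∀ᵐ ω ∂μ, Tendsto (fun n => Y n ω) atTop (𝓝 (Yl ω))) :
    ∀ᵐ ω ∂μ, Tendsto (fun n => (μ[Y n | ℱ n]) ω) atTop (𝓝 ((μ[Yl | ⨅ n, ℱ n]) ω)) := by
  have hinf : (⨅ n, ℱ n) ≤ m₀ := (iInf_le ℱ 0).trans (hle 0)
  -- integrability
  have hYl_dom : ∀ᵐ ω ∂μ, |Yl ω| ≤ Z ω := by
    filter_upwards [hlim, ae_all_iff.2 hdom] with ω hω hd
    exact le_of_tendsto hω.abs (Eventually.of_forall hd)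
  have hY_int : ∀ n, Integrable (Y n) μ := fun n =>
    hZ.mono' (hY n).aestronglyMeasurable (by
      filter_upwards [hdom n] with ω hω; rwa [Real.norm_eq_abs])
  have hYl_int : Integrable Yl μ :=
    hZ.mono' hYl.aestronglyMeasurable (by
      filter_upwards [hYl_dom] with ω hω; rwa [Real.norm_eq_abs])
  -- `D n = |Y_n − Y|`, `V N = sup_k D (N + k)`
  set D : ℕ → Ω → ℝ := fun n ω => |Y n ω - Yl ω| with hD
  set V : ℕ → Ω → ℝ := fun N ω => ⨆ k : ℕ, D (N + k) ω with hV
  have hD_meas : ∀ n, Measurable (D n) := fun n =>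
    continuous_abs.measurable.comp ((hY n).sub hYl)
  have hV_meas : ∀ N, Measurable (V N) := fun N => Measurable.iSup fun k => hD_meas (N + k)
  have hgood : ∀ᵐ ω ∂μ, (∀ n, D n ω ≤ 2 * Z ω) ∧ Tendsto (fun n => D n ω) atTop (𝓝 0) := by
    filter_upwards [hlim, ae_all_iff.2 hdom, hYl_dom] with ω hω hd hl
    refine ⟨fun n => ?_, ?_⟩
    · calc D n ω = |Y n ω - Yl ω| := rfl
        _ ≤ |Y n ω| + |Yl ω| := abs_sub _ _
        _ ≤ 2 * Z ω := by linarith [hd n]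
    · have h := (hω.sub_const (Yl ω)).abs
      rw [sub_self, abs_zero] at h
      exact h
  have hV_props : ∀ᵐ ω ∂μ, (∀ N k, D (N + k) ω ≤ V N ω) ∧ (∀ N, V N ω ≤ 2 * Z ω) ∧
      (∀ N, 0 ≤ V N ω) ∧ Antitone (fun N => V N ω) ∧ Tendsto (fun N => V N ω) atTop (𝓝 0) := by
    filter_upwards [hgood] with ω hω
    obtain ⟨hbd, htd⟩ := hω
    have hbdd : ∀ N, BddAbove (Set.range fun k => D (N + k) ω) := fun N =>
      ⟨2 * Z ω, fun y ⟨k, hk⟩ => hk ▸ hbd (N + k)⟩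
    have h1 : ∀ N k, D (N + k) ω ≤ V N ω := fun N k => le_ciSup (hbdd N) k
    have h2 : ∀ N, V N ω ≤ 2 * Z ω := fun N => ciSup_le fun k => hbd (N + k)
    have h3 : ∀ N, 0 ≤ V N ω := fun N => (abs_nonneg _).trans (h1 N 0)
    have h4 : Antitone (fun N => V N ω) := by
      refine antitone_nat_of_succ_le fun N => ciSup_le fun k => ?_
      have h := h1 N (k + 1)
      rwa [show N + (k + 1) = N + 1 + k by ring] at h
    refine ⟨h1, h2, h3, h4, ?_⟩
    rw [Metric.tendsto_atTop]
    intro ε hε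
    obtain ⟨N₀, hN₀⟩ := (Metric.tendsto_atTop.1 htd) (ε / 2) (by positivity)
    refine ⟨N₀, fun N hN => ?_⟩
    rw [Real.dist_0_eq_abs, abs_of_nonneg (h3 N)]
    refine lt_of_le_of_lt (ciSup_le fun k => ?_) (half_lt_self hε)
    have h := hN₀ (N + k) (hN.trans (Nat.le_add_right _ _))
    rw [Real.dist_0_eq_abs, abs_of_nonneg (abs_nonneg _)] at h
    exact h.le
  have hV_int : ∀ N, Integrable (V N) μ := fun N =>
    (hZ.const_mul 2).mono' (hV_meas N).aestronglyMeasurable (by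
      filter_upwards [hV_props] with ω hω
      rw [Real.norm_eq_abs, abs_of_nonneg (hω.2.2.1 N)]
      exact hω.2.1 N)
  -- `∫ V N → 0` (dominated convergence)
  have hintV : Tendsto (fun N => ∫ ω, V N ω ∂μ) atTop (𝓝 0) := by
    have h := tendsto_integral_of_dominated_convergence (fun ω => 2 * Z ω)
      (F := fun N ω => V N ω) (f := fun _ => (0 : ℝ))
      (fun N => (hV_meas N).aestronglyMeasurable) (hZ.const_mul 2)
      (fun N => by
        filter_upwards [hV_props] with ω hω
        rw [Real.norm_eq_abs, abs_of_nonneg (hω.2.2.1 N)]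
        exact hω.2.1 N) ?_
    · simpa using h
    · filter_upwards [hV_props] with ω hω using hω.2.2.2.2
  -- `G N = E(V_N | 𝓕_{−∞})` decreases a.e. to `0`
  set G : ℕ → Ω → ℝ := fun N => μ[V N | ⨅ n, ℱ n] with hG
  have hG_anti : ∀ᵐ ω ∂μ, ∀ N, G (N + 1) ω ≤ G N ω := by
    refine ae_all_iff.2 fun N => ?_
    refine condExp_mono (hV_int (N + 1)) (hV_int N) ?_
    filter_upwards [hV_props] with ω hω using hω.2.2.2.1 (Nat.le_succ N)
  have hG_nn : ∀ᵐ ω ∂μ, ∀ N, 0 ≤ G N ω := by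
    refine ae_all_iff.2 fun N => ?_
    have h := condExp_nonneg (μ := μ) (m := ⨅ n, ℱ n) (f := V N)
      (by filter_upwards [hV_props] with ω hω using hω.2.2.1 N)
    filter_upwards [h] with ω hω
    simpa using hω
  have hG_meas : ∀ N, Measurable (G N) := fun N =>
    (stronglyMeasurable_condExp.mono hinf).measurable
  have hG_int : ∀ N, Integrable (G N) μ := fun N => integrable_condExp
  have hG_tendsto : ∀ᵐ ω ∂μ, Tendsto (fun N => G N ω) atTop (𝓝 0) := by
    set Gi : Ω → ℝ := fun ω => ⨅ N, G N ω with hGi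
    have hGi_meas : Measurable Gi := Measurable.iInf hG_meas
    have hGi_le : ∀ᵐ ω ∂μ, ∀ N, Gi ω ≤ G N ω := by
      filter_upwards [hG_nn] with ω hω N
      exact ciInf_le ⟨0, fun y ⟨M, hM⟩ => hM ▸ hω M⟩ N
    have hGi_nn : ∀ᵐ ω ∂μ, 0 ≤ Gi ω := by
      filter_upwards [hG_nn] with ω hω
      exact le_ciInf hω
    have hGi_int : Integrable Gi μ :=
      (hG_int 0).mono' hGi_meas.aestronglyMeasurable (by
        filter_upwards [hGi_le, hGi_nn] with ω h1 h2
        rw [Real.norm_eq_abs, abs_of_nonneg h2]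
        exact h1 0)
    have hGi_int_le : ∀ N, ∫ ω, Gi ω ∂μ ≤ ∫ ω, V N ω ∂μ := by
      intro N
      calc ∫ ω, Gi ω ∂μ ≤ ∫ ω, G N ω ∂μ :=
            integral_mono_ae hGi_int (hG_int N) (by
              filter_upwards [hGi_le] with ω hω using hω N)
        _ = ∫ ω, V N ω ∂μ := integral_condExp hinf
    have hGi_zero : Gi =ᵐ[μ] 0 := by
      have h0 : ∫ ω, Gi ω ∂μ ≤ 0 := ge_of_tendsto' hintV hGi_int_le
      have h1 : ∫ ω, Gi ω ∂μ = 0 := le_antisymm h0 (integral_nonneg_of_ae hGi_nn)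
      exact (integral_eq_zero_iff_of_nonneg_ae hGi_nn hGi_int).1 h1
    filter_upwards [hGi_zero, hG_anti, hG_nn] with ω h0 ha hn
    have hanti' : Antitone (fun N => G N ω) := antitone_nat_of_succ_le ha
    have h := tendsto_atTop_ciInf hanti' ⟨0, fun y ⟨M, hM⟩ => hM ▸ hn M⟩
    rwa [show (⨅ N, G N ω) = 0 from h0] at h
  -- the comparison `|E(Y_n|𝓕_n) − E(Y|𝓕_n)| ≤ E(V_N|𝓕_n)` for `n ≥ N`, a.e.
  have hcmp : ∀ᵐ ω ∂μ, ∀ N n, N ≤ n →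
      |(μ[Y n | ℱ n]) ω - (μ[Yl | ℱ n]) ω| ≤ (μ[V N | ℱ n]) ω := by
    refine ae_all_iff.2 fun N => ae_all_iff.2 fun n => ?_
    by_cases hNn : N ≤ n
    · have h1 := condExp_sub (hY_int n) hYl_int (ℱ n) (μ := μ)
      have h2 := abs_condExp_ae_le_condExp_abs (μ := μ) (m := ℱ n) ((hY_int n).sub hYl_int)
      have h3 : μ[fun ω => |(Y n - Yl) ω| | ℱ n] ≤ᵐ[μ] μ[V N | ℱ n] := by
        refine condExp_mono ((hY_int n).sub hYl_int).abs (hV_int N) ?_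
        filter_upwards [hV_props] with ω hω
        have h := hω.1 N (n - N)
        rwa [Nat.add_sub_cancel' hNn] at h
      filter_upwards [h1, h2, h3] with ω h1 h2 h3 _
      rw [← Pi.sub_apply (μ[Y n | ℱ n]), ← h1]
      exact h2.trans h3
    · exact ae_of_all _ fun ω h => absurd h hNn
  -- Lévy's downward theorem (Theorem 4.7.3) for each `V N` and for `Y`
  have hupV : ∀ᵐ ω ∂μ, ∀ N, Tendsto (fun n => (μ[V N | ℱ n]) ω) atTop (𝓝 (G N ω)) :=
    ae_all_iff.2 fun N => Durrett2019_thm_4_7_3 hanti hle (hV_int N)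
  have hupY : ∀ᵐ ω ∂μ, Tendsto (fun n => (μ[Yl | ℱ n]) ω) atTop (𝓝 ((μ[Yl | ⨅ n, ℱ n]) ω)) :=
    Durrett2019_thm_4_7_3 hanti hle hYl_int
  -- conclusion
  filter_upwards [hcmp, hupV, hupY, hG_tendsto] with ω hcmp hupV hupY hG
  have hdiff : Tendsto (fun n => (μ[Y n | ℱ n]) ω - (μ[Yl | ℱ n]) ω) atTop (𝓝 0) := by
    rw [Metric.tendsto_atTop]
    intro ε hε
    obtain ⟨N, hN⟩ := (Metric.tendsto_atTop.1 hG) (ε / 2) (by positivity)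
    have hGN : G N ω < ε / 2 := by
      have h := hN N le_rfl
      rw [Real.dist_eq, sub_zero] at h
      exact lt_of_abs_lt h
    obtain ⟨N', hN'⟩ := (Metric.tendsto_atTop.1 (hupV N)) (ε / 2) (by positivity)
    refine ⟨max N N', fun n hn => ?_⟩
    rw [Real.dist_0_eq_abs]
    have h1 := hcmp N n ((le_max_left _ _).trans hn)
    have h2 := hN' n ((le_max_right _ _).trans hn)
    rw [Real.dist_eq] at h2
    have h3 : (μ[V N | ℱ n]) ω < ε := by linarith [le_abs_self ((μ[V N | ℱ n]) ω - G N ω)]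
    exact lt_of_le_of_lt h1 h3
  have h := hdiff.add hupY
  rw [zero_add] at h
  exact h.congr fun n => by ring

end Literature.Probability.Process
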